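import Summits.HubbardSuperconductivity.HubbardSuperconductivity.Theses.InfiniteVolumeFirst
import Literature.Barriers.HubbardSuperconductivity.PureModelStripeCompetitionProofs

/-!
# Crux `NoInfraredPileUp` (item `stmt-HubbardSuperconductivity-18534`, route InfiniteVolumeFirst rank 3):
# the family quantifier is NOT a weakening — the crux implies its state-uniform normal form

`noInfraredPileUp_uniform`.  The crux lets the window `ε` and the threshold side `L₀` depend on the
admissible ground-state FAMILY `ψ = (ψ_L)_L` (`∀ families ∀ η ∃ ε ∃ L₀ ∀ L`).  Since admissibility is a
condition side by side (unit ground state of `hubbardTorus 2 L 1 U` in the sector `(2⌊(1-δ)L²/2⌋, 0)` at each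
even `L`, no coherence between sides), the admissible families form a PRODUCT over `L`, and a diagonal
family built from bad ground states at the windows `1/(k+1)` shows that the crux already implies the
STATE-UNIFORM statement

  `∀ δ ∃ U₁ ∀ U < U₁ ∀ η > 0 ∃ ε > 0 ∃ L₀ ∀ even L ≥ L₀ ∀ unit sector ground states ψ on the L-torus, T_ε(ψ) ≤ η L²`

(`T_ε(ψ) = Σ_{m ≠ 0, |q_m| ≤ ε} S_ψ(m)`), which trivially implies the crux back (recorded in the disprover's
work file `Cruxes/NoInfraredPileUp/Disproof.lean` §4; not landed here, its conclusion being the crux).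
Consequences.  (i) REFUTATION SURFACE: to kill the crux it suffices to exhibit ONE `η > 0` and, for every
window `ε` and threshold `L₀`, ONE unit sector ground state on ONE even torus `L ≥ L₀` with `T_ε > η L²` —
no coherent sequence, no thermodynamic-limit state is needed (contrast the rank-2 crux).  (ii) For provers:
nothing is gained from the freedom `ε = ε(ψ)`; the content is a bound uniform over the ground eigenspaces
of all large even tori at fixed `(U, δ)`.  Helper: `windowSum_mono` (the window sum is monotone in `ε`).
Standing disprover, cdisprove cycle 1.  Sources: T. Kennedy, E. H. Lieb, B. S. Shastry, PRL 61 (1988) 2582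
(window sums of an order operator's structure factor); D. J. Scalapino, Phys. Rep. 250 (1995) 329, §2.
-/

-- the mandated namespace `Summit.<Summit>.<Problem>.Theorems` repeats `HubbardSuperconductivity`
-- (single-problem summit, D-0017), which the `dupNamespace` linter flags on every declaration
set_option linter.dupNamespace false

noncomputable section

namespace Summit.HubbardSuperconductivity.HubbardSuperconductivity.Theorems.NoInfraredPileUp.Negative

open Literature.MathematicalPhysics.QuantumLattice Literature.Probability.LatticeModels
  Literature.Barriers.HubbardSuperconductivity Matrix Finset
open Summit.HubbardSuperconductivity.HubbardSuperconductivity.Theses.InfiniteVolumeFirst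
open scoped ComplexOrder

/-- The window sum `T_ε(φ) = Σ_{m ≠ 0, |q_m| ≤ ε} S_φ(m)` is monotone in the window radius `ε ≥ 0`
(nonnegative summands, `pairStructureFactor_nonneg`). Kennedy–Lieb–Shastry, PRL 61 (1988) 2582. [folklore] -/
theorem windowSum_mono {L : ℕ} [NeZero L] (φ : Fock (Orb (FermionTorus 2 L))) {ε ε' : ℝ}
    (hε : 0 ≤ ε) (h : ε ≤ ε') :
    (∑ m : Fin 2 → ZMod L, if m ≠ 0 ∧ momentumNormSq L m ≤ ε ^ 2 then
        pairStructureFactor dWaveFormFactor L φ m else 0) ≤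
      (∑ m : Fin 2 → ZMod L, if m ≠ 0 ∧ momentumNormSq L m ≤ ε' ^ 2 then
        pairStructureFactor dWaveFormFactor L φ m else 0) := by
  refine Finset.sum_le_sum fun m _ => ?_
  have hsq : ε ^ 2 ≤ ε' ^ 2 := by nlinarith
  by_cases h1 : m ≠ 0 ∧ momentumNormSq L m ≤ ε ^ 2
  · rw [if_pos h1, if_pos ⟨h1.1, h1.2.trans hsq⟩]
  · rw [if_neg h1]
    split_ifs
    · exact pairStructureFactor_nonneg _ _ _ _
    · exact le_rfl

/-- **State-uniform normal form of `NoInfraredPileUp`.**  The crux (window and threshold side allowed to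
depend on the admissible ground-state family) implies the statement with `ε, L₀` depending on
`(δ, U, η)` only, uniformly over ALL unit `(2⌊(1-δ)L²/2⌋, 0)`-sector ground states of all large even tori.
Proof by contraposition with a DIAGONAL FAMILY: if the uniform statement fails at `(U, δ, η)`, choose for
each `k` a bad even side `s k` (strictly increasing, `s (k+1) > s k`) carrying a unit sector ground state
with `T_{1/(k+1)} > η (s k)²`; fill the other sides with arbitrary unit sector ground states
(`exists_unit_isGroundStateInSector_hubbardTorus`).  The family is admissible, so the crux yields `ε, L₀`;
at `k ≥ max L₀ ⌈1/ε⌉` the side `s k ≥ k ≥ L₀` has `T_ε ≥ T_{1/(k+1)} > η (s k)²` (`windowSum_mono`),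
a contradiction. Kennedy–Lieb–Shastry, PRL 61 (1988) 2582; Scalapino, Phys. Rep. 250 (1995) 329, §2.
[folklore] -/
theorem noInfraredPileUp_uniform (h : NoInfraredPileUp) :
    ∀ δ ∈ Set.Ioo (0:ℝ) (1 / 2), ∃ U₁ : ℝ, 0 < U₁ ∧ ∀ U ∈ Set.Ioo (0:ℝ) U₁,
      ∀ η : ℝ, 0 < η → ∃ ε : ℝ, 0 < ε ∧ ∃ L₀ : ℕ, ∀ (L : ℕ) [NeZero L], Even L → L₀ ≤ L →
        ∀ ψ : Fock (Orb (FermionTorus 2 L)), star ψ ⬝ᵥ ψ = 1 →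
          IsGroundStateInSector (hubbardTorus 2 L 1 U) (2 * ⌊(1 - δ) * (L : ℝ) ^ 2 / 2⌋₊) 0 ψ →
            (∑ m : Fin 2 → ZMod L, if m ≠ 0 ∧ momentumNormSq L m ≤ ε ^ 2 then
                pairStructureFactor dWaveFormFactor L ψ m else 0) ≤ η * (L : ℝ) ^ 2 := by
  intro δ hδ
  obtain ⟨U₁, hU₁, hcrux⟩ := h δ hδ
  refine ⟨U₁, hU₁, fun U hU η hη => ?_⟩
  have hδ1 : (-1 : ℝ) ≤ δ := by linarith [hδ.1]
  by_contra hbad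
  push Not at hbad
  -- bad sides and bad unit sector ground states at the windows `1/(k+1)`
  have hkpos : ∀ k : ℕ, (0 : ℝ) < 1 / ((k : ℝ) + 1) := fun k => by positivity
  choose side inst hEven hle ψb hψb1 hψbGS hψbT using
    fun (k : ℕ) (L₀ : ℕ) => hbad (1 / ((k : ℝ) + 1)) (hkpos k) L₀
  -- the diagonal sequence of sides `s 0 = side 0 0`, `s (k+1) = side (k+1) (s k + 1)` and its thresholds
  obtain ⟨s, hs0, hs⟩ : ∃ s : ℕ → ℕ, s 0 = side 0 0 ∧ ∀ k, s (k + 1) = side (k + 1) (s k + 1) :=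
    ⟨fun k => Nat.rec (side 0 0) (fun k sk => side (k + 1) (sk + 1)) k, rfl, fun _ => rfl⟩
  obtain ⟨pre, hpre0, hpre⟩ : ∃ pre : ℕ → ℕ, pre 0 = 0 ∧ ∀ k, pre (k + 1) = s k + 1 :=
    ⟨fun k => Nat.rec 0 (fun k _ => s k + 1) k, rfl, fun _ => rfl⟩
  have hspre : ∀ k, s k = side k (pre k) := by
    intro k
    cases k with
    | zero => rw [hs0, hpre0]
    | succ k => rw [hs, hpre]
  have hsmono : StrictMono s := by
    refine strictMono_nat_of_lt_succ fun k => ?_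
    have h1 := hle (k + 1) (s k + 1)
    rw [← hs] at h1
    omega
  -- the diagonal family: the bad state at the sides `s k`, any unit sector ground state elsewhere
  have key : ∀ L : ℕ, ∃ φ : Fock (Orb (FermionTorus 2 L)),
      (star φ ⬝ᵥ φ = 1 ∧
        IsGroundStateInSector (hubbardTorus 2 L 1 U) (2 * ⌊(1 - δ) * (L : ℝ) ^ 2 / 2⌋₊) 0 φ) ∧
      ∀ k : ℕ, s k = L → ∃ _ : NeZero L, η * (L : ℝ) ^ 2 <
        ∑ m : Fin 2 → ZMod L, if m ≠ 0 ∧ momentumNormSq L m ≤ (1 / ((k : ℝ) + 1)) ^ 2 then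
          pairStructureFactor dWaveFormFactor L φ m else 0 := by
    intro L
    by_cases hL : ∃ k, s k = L
    · obtain ⟨k, hk⟩ := hL
      subst hk
      rw [hspre k]
      refine ⟨ψb k (pre k), ⟨hψb1 k (pre k), hψbGS k (pre k)⟩, fun k' hk' => ?_⟩
      have hkk : k' = k := hsmono.injective (hk'.trans (hspre k).symm)
      subst hkk
      exact ⟨inst k' (pre k'), hψbT k' (pre k')⟩
    · obtain ⟨φ, hφ1, hφGS⟩ := exists_unit_isGroundStateInSector_hubbardTorus U L _
        (natFloor_filling_le_sq hδ1 L)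
      exact ⟨φ, ⟨hφ1, hφGS⟩, fun k hk => (hL ⟨k, hk⟩).elim⟩
  choose φ hφ using key
  have hadm : ∀ L, Even L → (fun L : ℕ => 2 * ⌊(1 - δ) * (L : ℝ) ^ 2 / 2⌋₊) L =
        2 * ⌊(1 - δ) * (L : ℝ) ^ 2 / 2⌋₊ ∧ star (φ L) ⬝ᵥ φ L = 1 ∧
      IsGroundStateInSector (hubbardTorus 2 L 1 U)
        ((fun L : ℕ => 2 * ⌊(1 - δ) * (L : ℝ) ^ 2 / 2⌋₊) L) 0 (φ L) :=
    fun L _ => ⟨rfl, (hφ L).1.1, (hφ L).1.2⟩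
  -- the crux on the diagonal family
  obtain ⟨ε, hε, L₀, hwin⟩ := hcrux U hU _ φ hadm η hη
  -- the index `k ≥ max L₀ ⌈1/ε⌉`
  obtain ⟨k, hkdef⟩ : ∃ k : ℕ, k = L₀ + ⌈1 / ε⌉₊ := ⟨_, rfl⟩
  have hksk : k ≤ s k := hsmono.id_le k
  have hkL₀ : L₀ ≤ s k := le_trans (by omega) hksk
  have hkε : 1 / ((k : ℝ) + 1) ≤ ε := by
    have h1 := Nat.le_ceil (1 / ε)
    have h2 : ((⌈1 / ε⌉₊ : ℕ) : ℝ) ≤ k := by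
      rw [hkdef]; push_cast; linarith [show (0:ℝ) ≤ L₀ from Nat.cast_nonneg _]
    have h3 : 1 / ε < (k : ℝ) + 1 := by linarith
    rw [div_le_iff₀ (by positivity)]
    rw [div_lt_iff₀ hε] at h3
    linarith
  have hEvk : Even (s k) := by rw [hspre]; exact hEven k (pre k)
  obtain ⟨hinst, hT⟩ := (hφ (s k)).2 k rfl
  have hw := @hwin (s k) hinst hEvk hkL₀
  have hmono := @windowSum_mono (s k) hinst (φ (s k)) _ _ (hkpos k).le hkε
  linarith [hT, hw, hmono]

end Summit.HubbardSuperconductivity.HubbardSuperconductivity.Theorems.NoInfraredPileUp.Negative
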